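import Literature.AlgebraicGeometry.HodgeTheory.MiddleDimensionReductionOfDeRham
import Literature.AlgebraicGeometry.HodgeTheory.HodgeFiltrationModelsReductionProofs
import Literature.AlgebraicGeometry.HodgeTheory.ComplexConjugationHolds
import Literature.NumberTheory.Transcendental.DeRhamTheoremMultiplicative
import HarnessLib

/-!
# BFNP Lemma 48 holds: discharge of `middleDimensionReduction`

**Discharge of the named fact `Literature.AlgebraicGeometry.HodgeTheory.middleDimensionReduction`**
(P. Brosnan, H. Fang, Z. Nie, G. Pearlstein, *Singularities of admissible normal functions*,
Invent. Math. 177 (2009), §6, Lemma 48: if every rational middle-degree Hodge class on every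
even-dimensional smooth projective complex variety is algebraic, then every rational `(p,p)`-class
on every smooth projective complex variety is algebraic; printed proof: products with projective
spaces below the middle, general linear sections and weak Lefschetz above it).

The reduction itself is the theorem `middleDimensionReduction_of_exists_deRhamIsoFamily hA hI hdR`
(`MiddleDimensionReductionOfDeRham`: the formalised printed proof from three named facts — (A) Hodge
models of smooth projective varieties, (I) independence of `H^{p,q}` from the model, (dR) de Rham's
theorem in its multiplicative form `Literature.NumberTheory.Transcendental.exists_deRhamIsoFamily
𝓘(ℝ, E)` for every finite-dimensional complex model space `E`). All three are now theorems of the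
tree: `nonempty_hodgeModel_holds` (`ComplexConjugationHolds`),
`hodgePQ_independent_of_hodgeModel_holds` (`HodgeFiltrationModelsReductionProofs`) and
`Literature.NumberTheory.Transcendental.exists_deRhamIsoFamily_holds` (`DeRhamTheoremMultiplicative`,
Warner Thm. 5.36 / 5.45: the integration family is natural, multiplicative and normalised; landed
2026-08-16) — so the fact closes (equivalently: `middleDimensionReduction_of_multiplicative_deRham`
of `MiddleDimensionReductionOfMultiplicativeDeRham` fed with the last one):

* `middleDimensionReduction_holds : middleDimensionReduction`;
* `hodgeConjectureFor_of_middleDimension_holds` — the Hodge conjecture for every smooth projective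
  `X/ℂ` from its middle-dimensional case on even-dimensional varieties, unconditionally
  (Hodge models by `nonempty_hodgeModel_holds`).

Everything is proved; no named facts remain in the cone (`#print axioms`: `propext`,
`Classical.choice`, `Quot.sound`).

## References

* P. Brosnan, H. Fang, Z. Nie, G. Pearlstein, *Singularities of admissible normal functions*,
  Invent. Math. 177 (2009), §6, Lemma 48 (arXiv:0711.0964, p. 13). [BrosnanFangNiePearlstein2009]
* F. W. Warner, *Foundations of Differentiable Manifolds and Lie Groups*, GTM 94 (1983),
  Thm. 5.36, Thm. 5.45. [WarnerGTM94]
-/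

noncomputable section

open scoped Manifold ContDiff

namespace Literature.AlgebraicGeometry.HodgeTheory

/-- **BFNP Lemma 48 holds** (discharge of the named fact `middleDimensionReduction`): if every
rational middle-degree Hodge class on every even-dimensional smooth projective complex variety is
algebraic (lies in `algebraicClasses X m`), then every rational `(p,p)`-class on every smooth
projective complex variety of any dimension lies in `algebraicClasses X p`. The reduction
`middleDimensionReduction_of_exists_deRhamIsoFamily` fed with the theorems `nonempty_hodgeModel_holds`,
`hodgePQ_independent_of_hodgeModel_holds` and de Rham's theorem
`Literature.NumberTheory.Transcendental.exists_deRhamIsoFamily_holds` (the complex model space `E`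
seen as a real one). [cite: BrosnanFangNiePearlstein2009, §6 Lemma 48]
[cite: WarnerGTM94, Thm. 5.36 / Thm. 5.45] -/
theorem middleDimensionReduction_holds : middleDimensionReduction :=
  middleDimensionReduction_of_exists_deRhamIsoFamily (fun _ _ ↦ nonempty_hodgeModel_holds)
    hodgePQ_independent_of_hodgeModel_holds fun E _ _ _ ↦
    Literature.NumberTheory.Transcendental.exists_deRhamIsoFamily_holds E

/-- **The Hodge conjecture from its middle-dimensional case** (unconditional form of
`hodgeConjectureFor_of_middleDimension`): if every rational Hodge class of type `(m, m)` on every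
smooth projective complex variety of even dimension `2m` is algebraic, then `HodgeConjectureFor n X`
holds for every smooth projective `X/ℂ` of every dimension `n` (both conjuncts: the Hodge model by
`nonempty_hodgeModel_holds`, the cycle statement by `middleDimensionReduction_holds`).
[cite: BrosnanFangNiePearlstein2009, §6 Lemma 48] -/
theorem hodgeConjectureFor_of_middleDimension_holds
    (hmid : ∀ ⦃m : ℕ⦄ ⦃X : Motives.SchemeOver ℂ⦄, Motives.IsSmoothProjective (2 * m) X →
      ∀ c : complexBetti X (2 * m), IsRationalClass c → IsOfHodgeType (2 * m) X (2 * m) m m c →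
        c ∈ algebraicClasses X m)
    {n : ℕ} {X : Motives.SchemeOver ℂ} (hX : Motives.IsSmoothProjective n X) :
    HodgeConjectureFor n X :=
  hodgeConjectureFor_of_middleDimension middleDimensionReduction_holds
    (fun _ _ hY ↦ nonempty_hodgeModel_holds hY) hmid hX

end Literature.AlgebraicGeometry.HodgeTheory

end
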